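import Mathlib

/-!
# Chart form ⟹ stalk form of the divisorial hypothesis (programme T of chain w45c, input of S4-scheme)

(crux stmt-ResolutionOfSingularities-15640 `WildQuotients.WildQuotientResolution`, line `Sketch`;
[OURS · L1 W4.5c] — NOT a statement of any manuscript.)

Base-free companion of `CyclicTransfer.map_augIdeal_germ` / `stub_augIdeal_localization_of_stalk`
(which go stalk ⟹ chart inside an `ActionOver`): for an endomorphism `γ : X → X` of a scheme, an
affine open `W` with `W ⊆ γ⁻¹ W` and a point `x ∈ W` fixed by `γ`, the germ map
`Γ(X, W) → 𝒪_{X,x}` intertwines the pull-back `γ♯ : Γ(X, W) → Γ(X, W)` (`Scheme.Hom.appLE`) with the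
stalk endomorphism `a = stalkSpecializes ≫ γ.stalkMap x` (`germ_appLE`), the extension of the
augmentation ideal `(γ♯ b - b : b)` along the germ map is the augmentation ideal `(a s - s : s)` of
the stalk (`map_span_appLE_sub_germ`; `𝒪_{X,x}` is a localisation of `Γ(X, W)`), and hence:
**if the chart augmentation ideal `(γ♯ b - b : b ∈ Γ(X, W))` is principal, so is the stalk
augmentation ideal at every `γ`-fixed point of `W`** (`isPrincipal_stalkAug_of_isPrincipal_appLE`) —
the form in which the terminal-model hypothesis `hdiv` of `CyclicTransfer.cyclicDivisorialTransfer`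
is stated. The chart computation for `Bl_{(x₀,x₂)} 𝔸⁴` is `TwoBlocks.stub_twoBlocks_chart_augIdeal`.
-/

-- single-problem summit: the doubled namespace component `ResolutionOfSingularities` is forced
set_option linter.dupNamespace false

noncomputable section

universe u

open CategoryTheory AlgebraicGeometry TopologicalSpace

namespace Summit.ResolutionOfSingularities.ResolutionOfSingularities.Theorems.WildQuotientResolution.CyclicTransfer

/-- **The germ map intertwines `γ♯` with the stalk endomorphism.** For `W ⊆ γ⁻¹ W`, `x ∈ W` with
`γ x = x` and `b ∈ Γ(X, W)`: the germ at `x` of `γ♯ b = γ.appLE W W _ b` is the image of the germ of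
`b` under `stalkSpecializes ≫ γ.stalkMap x` (Mathlib `Scheme.Hom.germ_stalkMap`,
`TopCat.Presheaf.germ_stalkSpecializes`). [folklore] -/
theorem germ_appLE {X : Scheme.{u}} (γ : X ⟶ X) (W : X.Opens) (hW : W ≤ γ ⁻¹ᵁ W) (x : X)
    (hxW : x ∈ W) (hγx : γ.base x = x) (b : Γ(X, W)) :
    (X.presheaf.germ W x hxW).hom (γ.appLE W W hW b) =
      (X.presheaf.stalkSpecializes (specializes_of_eq hγx) ≫ γ.stalkMap x).hom
        ((X.presheaf.germ W x hxW).hom b) := by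
  rw [CommRingCat.comp_apply, TopCat.Presheaf.germ_stalkSpecializes_apply,
    Scheme.Hom.germ_stalkMap_apply, Scheme.Hom.appLE, CommRingCat.comp_apply,
    TopCat.Presheaf.germ_res_apply]

/-- **The extended augmentation ideal is the augmentation ideal of the stalk endomorphism.** With
`W` an AFFINE open, `W ⊆ γ⁻¹ W`, `x ∈ W` fixed by `γ` and `a = stalkSpecializes ≫ γ.stalkMap x`:
the extension along the germ map `Γ(X, W) → 𝒪_{X,x}` of `(γ♯ b - b : b ∈ Γ(X, W))` is
`(a s - s : s ∈ 𝒪_{X,x})` — `⊆` by `germ_appLE`; `⊇` because `𝒪_{X,x}` is the localisation of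
`Γ(X, W)` at the prime of `x` (`IsAffineOpen.isLocalization_stalk`): every `s` satisfies
`s · t = b` for germs `b, t` of sections with `t` a unit, and then
`(a s - s) · t = (a b - b) - a s · (a t - t)`. [folklore] -/
theorem map_span_appLE_sub_germ {X : Scheme.{u}} (γ : X ⟶ X) (W : X.Opens)
    (hWaff : IsAffineOpen W) (hW : W ≤ γ ⁻¹ᵁ W) (x : X) (hxW : x ∈ W) (hγx : γ.base x = x) :
    (Ideal.span (Set.range fun b : Γ(X, W) => γ.appLE W W hW b - b)).map
        (X.presheaf.germ W x hxW).hom =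
      Ideal.span (Set.range fun s : X.presheaf.stalk x =>
        (X.presheaf.stalkSpecializes (specializes_of_eq hγx) ≫ γ.stalkMap x).hom s - s) := by
  letI : Algebra Γ(X, W) (X.presheaf.stalk x) :=
    TopCat.Presheaf.algebra_section_stalk X.presheaf ⟨x, hxW⟩
  haveI : IsLocalization.AtPrime (X.presheaf.stalk x) (hWaff.primeIdealOf ⟨x, hxW⟩).asIdeal :=
    hWaff.isLocalization_stalk ⟨x, hxW⟩
  set a := X.presheaf.stalkSpecializes (specializes_of_eq hγx) ≫ γ.stalkMap x with ha
  set φ := X.presheaf.germ W x hxW with hφ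
  have hφa : ∀ b, φ.hom (γ.appLE W W hW b) = a.hom (φ.hom b) := germ_appLE γ W hW x hxW hγx
  set J := (Ideal.span (Set.range fun b : Γ(X, W) => γ.appLE W W hW b - b)).map φ.hom with hJ
  have hmem : ∀ b, a.hom (φ.hom b) - φ.hom b ∈ J := fun b => by
    rw [← hφa, ← map_sub]
    exact Ideal.mem_map_of_mem _ (Ideal.subset_span ⟨b, rfl⟩)
  apply le_antisymm
  · rw [hJ, Ideal.map_span]
    refine Ideal.span_le.mpr ?_
    rintro _ ⟨_, ⟨b, rfl⟩, rfl⟩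
    refine Ideal.subset_span ⟨φ.hom b, ?_⟩
    simp only [map_sub, hφa]
  · refine Ideal.span_le.mpr ?_
    rintro _ ⟨s, rfl⟩
    obtain ⟨⟨b, t⟩, hs⟩ := IsLocalization.surj (hWaff.primeIdealOf ⟨x, hxW⟩).asIdeal.primeCompl s
    have hu : IsUnit (φ.hom t) := IsLocalization.map_units (X.presheaf.stalk x) t
    change s * φ.hom t = φ.hom b at hs
    have key : (a.hom s - s) * φ.hom t =
        (a.hom (φ.hom b) - φ.hom b) - a.hom s * (a.hom (φ.hom t) - φ.hom t) := by
      rw [← hs, map_mul]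
      ring
    rw [SetLike.mem_coe, ← Ideal.mul_unit_mem_iff_mem J hu, key]
    exact J.sub_mem (hmem b) (J.mul_mem_left _ (hmem t))

/-- **Chart form ⟹ stalk form of the divisorial hypothesis.** If the augmentation ideal
`(γ♯ b - b : b ∈ Γ(X, W))` of the pull-back `γ♯` on the sections over a `γ`-stable affine open `W`
is PRINCIPAL, then at every point `x ∈ W` fixed by `γ` the augmentation ideal
`(a s - s : s ∈ 𝒪_{X,x})` of the stalk endomorphism `a = stalkSpecializes ≫ γ.stalkMap x` is
principal (it is the extension of the former along the germ map, `map_span_appLE_sub_germ`).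
This is the form of the hypothesis `hdiv` of `CyclicTransfer.cyclicDivisorialTransfer`.
[folklore] -/
theorem isPrincipal_stalkAug_of_isPrincipal_appLE {X : Scheme.{u}} (γ : X ⟶ X) (W : X.Opens)
    (hWaff : IsAffineOpen W) (hW : W ≤ γ ⁻¹ᵁ W)
    (hprin : (Ideal.span (Set.range fun b : Γ(X, W) => γ.appLE W W hW b - b)).IsPrincipal)
    (x : X) (hxW : x ∈ W) (hγx : γ.base x = x) :
    (Ideal.span (Set.range fun s : X.presheaf.stalk x =>
      (X.presheaf.stalkSpecializes (specializes_of_eq hγx) ≫ γ.stalkMap x).hom s - s)).IsPrincipal := by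
  rw [← map_span_appLE_sub_germ γ W hWaff hW x hxW hγx]
  exact hprin.map_ringHom _

end Summit.ResolutionOfSingularities.ResolutionOfSingularities.Theorems.WildQuotientResolution.CyclicTransfer

end
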